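import Summits.BirchSwinnertonDyer.BirchSwinnertonDyer.Theorems.Rank1ResidualJetCarrierEndFormsNamedPrintOnly
import Summits.BirchSwinnertonDyer.Rank1Residual.JET.HeegnerE0ReceptacleByName
import Literature.NumberTheory.EllipticCurves.ZywinaCMImageProofs
import HarnessLib

/-!
# T1 JET (cell `bsd-jet`), road K — END FORMS ⟸ NAMED PRINT with the receptacle schema `hGZ`
# replaced by the Literature fact `Gross1991_heegnerPoint_sub_ratTorsion_mem_E0` (F1) BY NAME

HONEST FRAMING (programme file §HONESTY, verbatim): «no tranche here proves BSD; ARM L moves the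
LITERAL column of an r ≤ 1 census into the kernel-proved-modulo-named-print column.» THEOREMS ONLY
(typer seat `bsd-jet-ty`, session g10); 0 classes move; road-K DOCUMENTARY end forms.

WHAT THIS IS. pv-2's END FORMS «named print only» (`Rank1ResidualJetCarrierEndFormsNamedPrintOnly`,
p539525) state the three reading binders K3 / K1 / K4
(`JetchevDivisibilityCarrier{Mult,Ne,Add}`) from {`h52`, `hCV`, `h44`, `hPT`, `hGZ`}, where `hGZ` is
still a CLOSED cite-only SCHEMA — [GZ86, III (3.1)] / Gross 1991 §6 in x11b3's receptacle form,
closed with the print's guards (`K` imaginary quadratic, `d_K ∉ {−3, −4}`, Heegner hypothesis for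
`N`, `p` odd, `ρ̄_{E,p}` onto, square-free conductors with Zhang–Kolyvagin prime factors) — whose
satisfiability reader 1 flagged as UNVERIFIED. The typer's T4 file
(`JET/HeegnerE0ReceptacleByName`, p536408) proved that schema, curve by curve, from the Literature
FACT `Gross1991_heegnerPoint_sub_ratTorsion_mem_E0` (`HeegnerPointsIdentityComponent`, p471738:
«`y_m − Frob y_{m/ℓ} ∈ E₀` up to rational torsion», Gross 1991 Prop. 3.7 / §6 with [GZ86 III (3.1)])
under ONE extra standing hypothesis of that fact, `¬ W.HasCM`. The closed schema of p539525 carries no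
`¬CM` guard, but it carries `p ≠ 2` and `ρ̄_{E,p}` onto, and a CM curve over `ℚ` is never surjective
mod an odd prime — Zywina 2015 Prop. 1.14/1.16 = Serre 1972 §4.5, PROVED in the tree as
`WeierstrassCurve.not_hasSurjectiveModNGaloisRep_of_hasCM` (`ZywinaCMImageProofs`). Hence:

* `forall_hGZ_of_Gross1991 hF1` — the closed `hGZ` schema of p539525 VERBATIM, from F1;
* `jetchevDivisibilityCarrier{Mult,Ne,Add}_of_namedPrintGross1991 h52 hCV h44 hPT hF1` — the END
  FORMS with binder list EXACTLY five NAMED statements and no closed schema: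
  `McCallum1991.prop52_exists_conductor_kolyvaginClass_order_eq` ([McC] Prop. 5.2),
  `JET.JetchevCoreVertexExistence` (K5, [J] Prop. 5.3 read at `p ∣ N` — the one input that is a
  typed READING, not a published statement), `McCallum1991.prop44_localOrder_kolyvaginClass_mul_eq`
  ([McC] Prop. 4.4), `poitouTate_selmerStructure_duality_conj` (Poitou–Tate for Selmer structures,
  conjugation form), `Gross1991_heegnerPoint_sub_ratTorsion_mem_E0` (F1).

References: [cite: Jetchev2008, Thm. 1.4, Thm. 5.2, Prop. 4.9, Prop. 5.3]
[cite: McCallumLMS1991, Prop. 4.4, Prop. 5.2] [cite: GrossLMS1991, Prop. 3.7, §6]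
[cite: GrossZagier1986, III (3.1)] [cite: Zywina2015, Prop. 1.14 and Prop. 1.16 (§1.9)]
[cite: Serre1972, §4.5].
-/

set_option autoImplicit false

noncomputable section

open scoped Classical

open WeierstrassCurve IsDedekindDomain NumberField Field Literature.NumberTheory.EllipticCurves
  Literature.NumberTheory.EllipticCurves.ModularForms Literature.NumberTheory.EllipticCurves.Jetchev2008
  Literature.NumberTheory.GaloisRepresentations Literature.NumberTheory.GaloisCohomology
  Literature.NumberTheory.GaloisRepresentations.DiscreteGaloisModule
  Summit.BirchSwinnertonDyer.Rank1Residual.X11b Summit.BirchSwinnertonDyer.Rank1Residual.X11b.Three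
  Summit.BirchSwinnertonDyer.Rank1Residual.JET.SelmerVocabulary Literature.NumberTheory.Automorphic

namespace Summit.BirchSwinnertonDyer.Rank1Residual.JET

/-- **The END FORMS' closed receptacle schema `hGZ` (p539525's binder, VERBATIM) from the Literature
fact F1.** At each curve the `¬CM` standing hypothesis of F1 is supplied by the schema's own guards
`p ≠ 2` and `ρ̄_{E,p}` onto (`WeierstrassCurve.not_hasSurjectiveModNGaloisRep_of_hasCM`); the rest is
`hGZ_of_Gross1991` (witness `n' = #E(ℚ)_tors`). [cite: GrossLMS1991, Prop. 3.7, §6]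
[cite: GrossZagier1986, III (3.1)] [cite: Zywina2015, Prop. 1.14 and Prop. 1.16 (§1.9)]
[cite: Serre1972, §4.5] -/
theorem forall_hGZ_of_Gross1991 (hF1 : Gross1991_heegnerPoint_sub_ratTorsion_mem_E0) :
    ∀ (W : WeierstrassCurve ℚ) [W.IsElliptic] [W.IsGloballyMinimal] [NeZero (W.conductorNorm ℤ)]
      (K : Type) [Field K] [NumberField K], IsImaginaryQuadratic K →
      NumberField.discr K ≠ -3 → NumberField.discr K ≠ -4 →
      SatisfiesHeegnerHypothesis (W.conductorNorm ℤ) K →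
      ∀ (p : ℕ) [Fact p.Prime], p ≠ 2 → W.HasSurjectiveModNGaloisRep p →
      ∀ (Dt : ModularParametrizationData W (W.conductorNorm ℤ)) (β : ℤ) (ι : K →+* ℂ)
      [∀ j : ℕ, NumberField (ringClassField K ι j)],
      ∃ n' : ℤ, IsCoprime (p : ℤ) n' ∧ ∀ (m : ℕ), Squarefree m →
        (∀ q ∈ m.primeFactors, Zhang2014.IsKolyvaginPrime (W.conductorNorm ℤ) W K p q) →
        ∀ (dm : KolyvaginHeegnerData Dt β ι m)
        (γ : ringClassField K ι m ≃ₐ[ℚ] ringClassField K ι m), γ ∈ ringClassGal ι m →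
        ∀ v : HeightOneSpectrum (𝓞 K), ¬ (W.baseChange K).HasGoodReductionAt v →
          n' • pointsMap (W.baseChange K) (v.adicCompletion K)
              (dm.toGeomPoints (pointGalHom W (ringClassField K ι m) γ dm.y)) ∈
            E0Receptacle (W.baseChange K) v ∧
          ∀ (ℓ : ℕ), ℓ ∈ m.primeFactors → ∀ (dm' : KolyvaginHeegnerData Dt β ι (m / ℓ))
            (hle : ringClassField K ι (m / ℓ) ≤ ringClassField K ι m),
            n' • pointsMap (W.baseChange K) (v.adicCompletion K)
                (dm.toGeomPoints (pointGalHom W (ringClassField K ι m) γ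
                  (WeierstrassCurve.Affine.Point.map (W' := W)
                    ((RingClassField.inclusion ι hle).restrictScalars ℚ) dm'.y))) ∈
              E0Receptacle (W.baseChange K) v :=
  fun W _ _ _ K _ _ hK hD3 hD4 hH p _ hp2 hsurj Dt β ι _ ↦
    hGZ_of_Gross1991 hF1 W
      (fun hcm ↦ W.not_hasSurjectiveModNGaloisRep_of_hasCM hcm Fact.out hp2 hsurj)
      K hK hD3 hD4 hH p hp2 hsurj Dt β ι

/-- **K3 ⟸ NAMED PRINT, every binder a named statement** (multiplicative carrier `p ∣ N`):
{[McC] Prop. 5.2, K5 core vertices, [McC] Prop. 4.4, Poitou–Tate for Selmer structures, F1}.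
[cite: Jetchev2008, Thm. 1.4, Thm. 5.2, Prop. 4.9, Prop. 5.3] [cite: McCallumLMS1991, Prop. 4.4, Prop. 5.2]
[cite: GrossLMS1991, Prop. 3.7, §6] [cite: GrossZagier1986, III (3.1)] -/
theorem jetchevDivisibilityCarrierMult_of_namedPrintGross1991
    (h52 : McCallum1991.prop52_exists_conductor_kolyvaginClass_order_eq)
    (hCV : JetchevCoreVertexExistence)
    (h44 : McCallum1991.prop44_localOrder_kolyvaginClass_mul_eq)
    (hPT : ∀ (K : Type) [Field K] [NumberField K], poitouTate_selmerStructure_duality_conj K)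
    (hF1 : Gross1991_heegnerPoint_sub_ratTorsion_mem_E0) :
    JetchevDivisibilityCarrierMult :=
  jetchevDivisibilityCarrierMult_of_namedPrintOnly h52 hCV h44 hPT (forall_hGZ_of_Gross1991 hF1)

/-- **K1 ⟸ NAMED PRINT, every binder a named statement** (carrier a prime `q ∣ N`, `q ≠ p`).
[cite: Jetchev2008, Thm. 1.4, Thm. 5.2, Prop. 4.9, Prop. 5.3] [cite: McCallumLMS1991, Prop. 4.4, Prop. 5.2]
[cite: GrossLMS1991, Prop. 3.7, §6] [cite: GrossZagier1986, III (3.1)] -/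
theorem jetchevDivisibilityCarrierNe_of_namedPrintGross1991
    (h52 : McCallum1991.prop52_exists_conductor_kolyvaginClass_order_eq)
    (hCV : JetchevCoreVertexExistence)
    (h44 : McCallum1991.prop44_localOrder_kolyvaginClass_mul_eq)
    (hPT : ∀ (K : Type) [Field K] [NumberField K], poitouTate_selmerStructure_duality_conj K)
    (hF1 : Gross1991_heegnerPoint_sub_ratTorsion_mem_E0) :
    JetchevDivisibilityCarrierNe :=
  jetchevDivisibilityCarrierNe_of_namedPrintOnly h52 hCV h44 hPT (forall_hGZ_of_Gross1991 hF1)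

/-- **K4 ⟸ NAMED PRINT, every binder a named statement** (additive carrier `p ∣ N`).
[cite: Jetchev2008, Thm. 1.4, Thm. 5.2, Prop. 4.9, Prop. 5.3] [cite: McCallumLMS1991, Prop. 4.4, Prop. 5.2]
[cite: GrossLMS1991, Prop. 3.7, §6] [cite: GrossZagier1986, III (3.1)] -/
theorem jetchevDivisibilityCarrierAdd_of_namedPrintGross1991
    (h52 : McCallum1991.prop52_exists_conductor_kolyvaginClass_order_eq)
    (hCV : JetchevCoreVertexExistence)
    (h44 : McCallum1991.prop44_localOrder_kolyvaginClass_mul_eq)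
    (hPT : ∀ (K : Type) [Field K] [NumberField K], poitouTate_selmerStructure_duality_conj K)
    (hF1 : Gross1991_heegnerPoint_sub_ratTorsion_mem_E0) :
    JetchevDivisibilityCarrierAdd :=
  jetchevDivisibilityCarrierAdd_of_namedPrintOnly h52 hCV h44 hPT (forall_hGZ_of_Gross1991 hF1)

end Summit.BirchSwinnertonDyer.Rank1Residual.JET

end
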